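import Literature.AnabelianGeometry.EtaleTheta.SettingModelChiInversionSectionTau
import Literature.AnabelianGeometry.EtaleTheta.ThetaCoversTemperedOfHuuSection
import HarnessLib

/-!
# [EtTh] Def. 2.7 / Cor. 2.8 (i): the `Dtau`-clause of `ThetaOrbitData.ofEmbedding` UP TO AN INNER AUTOMORPHISM from
# `Π^tp_{X̲̲}` — generic reduction to `Π^tp_X`, and its POSITIVE decision at the χ-models for every `Γ` restricting to the
# inversion (row R374 «hDtau′ INNER-ADJUSTED WITNESS AT THE MODEL»; PROOF-ONLY)

S. Mochizuki, *The étale theta function and its Frobenioid-theoretic manifestations*, Publ. RIMS **45** (2009) [EtTh], §1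
Def. 1.9 p. 29 / Rmk. 1.9.1 p. 29 («`ε_μ`, `ε_±` map `η̈^{Θ,Z} ↦ −η̈^{Θ,Z}`», i.e. `τ ↦ τ⁻¹`), proof of Thm. 1.10 pp. 29–30
(«`γ` maps [the decomposition groups over] `τ` to [those over] `τ^{±1}`»), §2 Def. 2.7 p. 41, Cor. 2.8 (i) p. 42
[cite: MochizukiEtTh2009, Cor 2.8 (i) p.42].

abc-iut cell, layer L2, seat abc-iut-w5-d118 (gen 6); abc-iut-L2-lead row R374 / R475 (un-parked by R413 = this seat's
`SettingModelChiInversionSectionTau`, p453439). The binder in question is the INNER-ADJUSTED `Dtau`-clause of this seat's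
`EtaleThetaDataOfSettingRootHypOfCor28iInner` (FINDING F-w5d118g5-1; consumers `…_innerAdjust`, abc-iut-w6-d051's
`…IntrinsicInner`, abc-iut-w6-d002's `…StableOfDelta`):
`∀ Γ : T.Gtp ≃ₜ* T.Gtp, (tower-stable Γ) → ∃ u ∈ C.Huu, ∀ Dt ∈ (ofEmbedding ε hC hS).Dtau,
   Dt.map (Γ.trans (innerAutTop (ε.ι u))) ∈ (ofEmbedding ε hC hS).Dtau`.
The `∀ Γ` form is a HYPOTHESIS about all tower-stabilising automorphisms of `Π^tp_C` (not kernel-decidable at a model); THIS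
FILE decides its two NAMEABLE `Γ`-classes POSITIVELY — so the repaired binder is CONSISTENT with the models, where the
un-adjusted v1 binder was not. PROOF-ONLY (no `def`, no instance, no `Prop` fact); all inputs BY NAME: abc-iut-L2-t2's
`OrbitEmbedding` / `ThetaOrbitData.ofEmbedding` / `decompUU` (`ThetaRootOrbitsOfSetting`), abc-iut-L2-d3's
`temperedCoverDataOfHuuOfSection` / `orbitEmbeddingOfHuuOfSection` (`ι := inclX`), abc-iut-L2-t10's `χ′` instance chain
(`cLevelDataInvχ'`, `toPiCHat`, `sectionχ'`, `iotaStable_conjX_epsPMInvχ'`, `barKerTp_le_Huuχ_inversionModelχ'`, …),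
abc-iut-w5-d140's `inversionModelχ′` (`inversionModelχ'_epsPM_conj`), this seat's p453439 (`map_conj_map_twistedInversion_sectionOfUnitχ`,
`map_sectionOfUnitχ_le_Huuχ`).

* §1 GENERIC (any `D`, `E`, `C`, `T`, `ε`): `OrbitEmbedding.map_decompUU_trans_innerAutTop` — if `Γ` restricts along `ε.ι` to
  `γ : Π^tp_X ≃* Π^tp_X` (`hΓ : Γ (ε.ι x) = ε.ι (γ x)`), then `(Γ ≫ γ_{ι g})(ι(D_y ∩ Π^tp_{X̲̲})) = ι(g·γ(D_y ∩ Π^tp_{X̲̲})·g⁻¹)`;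
  **`ThetaOrbitData.exists_mem_Huu_dtau_stable_of_swap`** / **`…_of_fix`** — ONE `g ∈ C.Huu` conjugating `γ(D_τ ∩ X̲̲)`
  onto `D_{τ⁻¹} ∩ X̲̲` and `γ(D_{τ⁻¹} ∩ X̲̲)` onto `D_τ ∩ X̲̲` (or each onto itself) gives the clause with `u := g`;
  **`…_of_inner`** — sub-case (a): `Γ` restricting to an inner automorphism `γ_h`, `h ∈ C.Huu` (`u := h⁻¹`);
* §2 AT THE χ-MODELS (`D := modelχ′`, resp. `modelχ`; `C.Huu = Huuχ p l`): **`exists_mem_Huu_dtau_stable_modelχ'`** /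
  `…_modelχ` — for EVERY orbit embedding whose points have `D_τ = s_u(G_K̈)`, `D_{τ⁻¹} = s_{u⁻¹}(G_K̈)` (the Def. 1.9 shape, any
  unit `u`) and EVERY `Γ` restricting to the twisted inversion on `Π^tp_X` (e.g. conjugation by `ε_±` at `inversionModelχ′`):
  the clause HOLDS (p453439 (D): the same `g = inl(b^{w·w}) ∈ Π^tp_{X̲̲} ∩ Π^tp_Ÿ` swaps the pair);
* §3 NON-VACUITY HEADLINE at the Kummer-carrying cusped inversion model: `ThetaSetting.modelχ'_sec2Hyps`;
  **`exists_orbitEmbedding_dtau_stable_inversionModelχ'`** — for every odd `l`, every `C` with `Π^tp_{X̲̲} = Huuχ p l` and every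
  pair of non-cuspidal points of Def. 1.9 shape: a `TemperedCoverData` ON `Π^tp_C(inversionModelχ′)`, an `OrbitEmbedding` with
  THESE points, and `Γ := γ_{ε_±} ≠ id` restricting to `ι`, for which the `Dtau`-clause holds (abc-iut-L2-t10's constructor chain).

HONEST FRAMING: SEMI-SYNTHETIC models (consistency / non-vacuity evidence for OUR typed interface ONLY); the `∀ Γ` binder is NOT
discharged (only its `ε_±` and inner classes); nothing of [EtTh] is asserted; typed ≠ proved; no side is taken on [IUTchIII] Cor. 3.12.
-/

noncomputable section

namespace Literature.AnabelianGeometry.EtaleTheta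

open Literature.AnabelianGeometry.SemiGraphs ThetaCovers
open _root_.Topology _root_.Function

universe u

/-! ### §1. Generic: the `Dtau`-clause of `ofEmbedding` reduces to `Π^tp_X` -/

namespace ThetaSetting.EtaleThetaData.DoubleUnderline.OrbitEmbedding

variable {p : ℕ} [Fact p.Prime] {D : ThetaSetting p} {E : D.EtaleThetaData} {l : ℕ} {C : E.DoubleUnderline l}
  {T : TemperedCoverData.{u} l} (ε : C.OrbitEmbedding T)

/-- **Bookkeeping**: for `Γ` restricting along `ε.ι` to `γ` (`Γ (ι x) = ι (γ x)`) and `g ∈ Π^tp_X`,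
`(Γ ≫ γ_{ι g})(ι(D_y ∩ Π^tp_{X̲̲})) = ι(g · γ(D_y ∩ Π^tp_{X̲̲}) · g⁻¹)`. [cite: MochizukiEtTh2009, Def 2.7 p.41] -/
theorem map_decompUU_trans_innerAutTop (Γ : T.Gtp ≃ₜ* T.Gtp) (γ : D.PiTemp ≃* D.PiTemp)
    (hΓ : ∀ x, Γ (ε.ι x) = ε.ι (γ x)) (g : D.PiTemp) (y : ThetaSetting.NonCuspidalPoint E.toKummerData) :
    (ε.decompUU y).map (Γ.trans (ThetaOrbitData.innerAutTop (ε.ι g))).toMulEquiv.toMonoidHom =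
      (((y.Dpt ⊓ C.Huu).map γ.toMonoidHom).map (MulAut.conj g).toMonoidHom).map ε.ι := by
  rw [decompUU, Subgroup.map_map, Subgroup.map_map, Subgroup.map_map]
  congr 1
  refine MonoidHom.ext fun x => ?_
  change ε.ι g * Γ (ε.ι x) * (ε.ι g)⁻¹ = ε.ι (g * γ x * g⁻¹)
  rw [hΓ, map_mul, map_mul, map_inv]

end ThetaSetting.EtaleThetaData.DoubleUnderline.OrbitEmbedding

namespace ThetaCovers.ThetaOrbitData

variable {p : ℕ} [Fact p.Prime] {D : ThetaSetting p} {E : D.EtaleThetaData} {l : ℕ} {C : E.DoubleUnderline l}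
  {T : TemperedCoverData.{u} l} (ε : C.OrbitEmbedding T) (hC : D.Compat) (hS : D.Sec2Hyps)

/-- **The inner-adjusted `Dtau`-clause, SWAP case**: if `Γ` restricts along `ε.ι` to `γ` and ONE `g ∈ Π^tp_{X̲̲}` conjugates
`γ(D_τ ∩ Π^tp_{X̲̲})` onto `D_{τ⁻¹} ∩ Π^tp_{X̲̲}` AND `γ(D_{τ⁻¹} ∩ Π^tp_{X̲̲})` onto `D_τ ∩ Π^tp_{X̲̲}`, then `Γ ≫ γ_{ι g}` permutes
`Dtau` («`γ` maps `τ` to `τ^{±1}`»). [cite: MochizukiEtTh2009, Cor 2.8 (i) p.42] -/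
theorem exists_mem_Huu_dtau_stable_of_swap (Γ : T.Gtp ≃ₜ* T.Gtp) (γ : D.PiTemp ≃* D.PiTemp)
    (hΓ : ∀ x, Γ (ε.ι x) = ε.ι (γ x)) {g : D.PiTemp} (hg : g ∈ C.Huu)
    (h₁ : ((ε.tau.Dpt ⊓ C.Huu).map γ.toMonoidHom).map (MulAut.conj g).toMonoidHom = ε.tauInv.Dpt ⊓ C.Huu)
    (h₂ : ((ε.tauInv.Dpt ⊓ C.Huu).map γ.toMonoidHom).map (MulAut.conj g).toMonoidHom = ε.tau.Dpt ⊓ C.Huu) :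
    ∃ u ∈ C.Huu, ∀ Dt ∈ (ofEmbedding ε hC hS).Dtau,
      Dt.map (Γ.trans (innerAutTop (ε.ι u))).toMulEquiv.toMonoidHom ∈ (ofEmbedding ε hC hS).Dtau := by
  refine ⟨g, hg, ?_⟩
  rintro Dt (rfl | rfl)
  · rw [ε.map_decompUU_trans_innerAutTop Γ γ hΓ g, h₁]
    exact Or.inr rfl
  · rw [ε.map_decompUU_trans_innerAutTop Γ γ hΓ g, h₂]
    exact Or.inl rfl

/-- **The inner-adjusted `Dtau`-clause, FIX case**: the same when `g` conjugates each of `γ(D_τ ∩ Π^tp_{X̲̲})`,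
`γ(D_{τ⁻¹} ∩ Π^tp_{X̲̲})` onto itself. [cite: MochizukiEtTh2009, Cor 2.8 (i) p.42] -/
theorem exists_mem_Huu_dtau_stable_of_fix (Γ : T.Gtp ≃ₜ* T.Gtp) (γ : D.PiTemp ≃* D.PiTemp)
    (hΓ : ∀ x, Γ (ε.ι x) = ε.ι (γ x)) {g : D.PiTemp} (hg : g ∈ C.Huu)
    (h₁ : ((ε.tau.Dpt ⊓ C.Huu).map γ.toMonoidHom).map (MulAut.conj g).toMonoidHom = ε.tau.Dpt ⊓ C.Huu)
    (h₂ : ((ε.tauInv.Dpt ⊓ C.Huu).map γ.toMonoidHom).map (MulAut.conj g).toMonoidHom = ε.tauInv.Dpt ⊓ C.Huu) :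
    ∃ u ∈ C.Huu, ∀ Dt ∈ (ofEmbedding ε hC hS).Dtau,
      Dt.map (Γ.trans (innerAutTop (ε.ι u))).toMulEquiv.toMonoidHom ∈ (ofEmbedding ε hC hS).Dtau := by
  refine ⟨g, hg, ?_⟩
  rintro Dt (rfl | rfl)
  · rw [ε.map_decompUU_trans_innerAutTop Γ γ hΓ g, h₁]
    exact Or.inl rfl
  · rw [ε.map_decompUU_trans_innerAutTop Γ γ hΓ g, h₂]
    exact Or.inr rfl

/-- **Sub-case (a)**: a `Γ` restricting along `ε.ι` to an INNER automorphism `γ_h`, `h ∈ Π^tp_{X̲̲}`, satisfies the clause with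
`u := h⁻¹` (`Γ ≫ γ_{ι h⁻¹}` fixes both members pointwise). [cite: MochizukiEtTh2009, Cor 2.8 (i) p.42] -/
theorem exists_mem_Huu_dtau_stable_of_inner (Γ : T.Gtp ≃ₜ* T.Gtp) {h : D.PiTemp} (hh : h ∈ C.Huu)
    (hΓ : ∀ x, Γ (ε.ι x) = ε.ι (h * x * h⁻¹)) :
    ∃ u ∈ C.Huu, ∀ Dt ∈ (ofEmbedding ε hC hS).Dtau,
      Dt.map (Γ.trans (innerAutTop (ε.ι u))).toMulEquiv.toMonoidHom ∈ (ofEmbedding ε hC hS).Dtau := by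
  have hid : (MulAut.conj h⁻¹).toMonoidHom.comp (MulAut.conj h).toMonoidHom = MonoidHom.id D.PiTemp :=
    MonoidHom.ext fun x => by
      change h⁻¹ * (h * x * h⁻¹) * h⁻¹⁻¹ = x
      group
  have key : ∀ K : Subgroup D.PiTemp,
      (K.map (MulAut.conj h).toMonoidHom).map (MulAut.conj h⁻¹).toMonoidHom = K := fun K => by
    rw [Subgroup.map_map, hid, Subgroup.map_id]
  exact exists_mem_Huu_dtau_stable_of_fix ε hC hS Γ (MulAut.conj h) hΓ (C.Huu.inv_mem hh) (key _) (key _)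

end ThetaCovers.ThetaOrbitData

/-! ### §2. At the χ-models: every `Γ` restricting to the inversion satisfies the clause at the Def. 1.9 pair -/

namespace SettingModel

variable (p : ℕ) [Fact p.Prime]

/-- **R374 at `modelχ′` (the cusped Kummer-carrying model of R312).** For every étale-theta datum `E` over `modelχ′`, every
choice `X̲̲` with `Π^tp_{X̲̲} = Huuχ p l`, every `TemperedCoverData` `T` and orbit embedding `ε` whose two points are the
Def. 1.9 pair of a unit `u` (`D_τ = s_u(G_K̈)`, `D_{τ⁻¹} = s_{u⁻¹}(G_K̈)`), and every `Γ ∈ Aut_top(Π^tp_C)` restricting along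
`ε.ι` to the twisted inversion: `∃ v ∈ Π^tp_{X̲̲}, ∀ Dt ∈ Dtau, (Γ ≫ γ_{ι v})(Dt) ∈ Dtau` — the inner-adjusted `Dtau`-clause
HOLDS for this `Γ`. [cite: MochizukiEtTh2009, Cor 2.8 (i) p.42] -/
theorem exists_mem_Huu_dtau_stable_modelχ' {E : (ThetaSetting.modelχ' p).EtaleThetaData} {l : ℕ+}
    {C : E.DoubleUnderline (l : ℕ)} (hCH : C.Huu = Huuχ p l) {T : TemperedCoverData.{0} l} (ε : C.OrbitEmbedding T)
    (hC : (ThetaSetting.modelχ' p).Compat) (hS : (ThetaSetting.modelχ' p).Sec2Hyps) (u : (↥(ThetaSetting.modelχ p).Kdd)ˣ)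
    (hτ : ε.tau.Dpt = (ThetaSetting.modelχ p).GKdd.map (sectionOfUnitχ p u))
    (hτ' : ε.tauInv.Dpt = (ThetaSetting.modelχ p).GKdd.map (sectionOfUnitχ p u⁻¹))
    (Γ : T.Gtp ≃ₜ* T.Gtp) (hΓ : ∀ x, Γ (ε.ι x) = ε.ι (twistedInversion (chi p) x)) :
    ∃ v ∈ C.Huu, ∀ Dt ∈ (ThetaOrbitData.ofEmbedding ε hC hS).Dtau,
      Dt.map (Γ.trans (ThetaOrbitData.innerAutTop (ε.ι v))).toMulEquiv.toMonoidHom ∈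
        (ThetaOrbitData.ofEmbedding ε hC hS).Dtau := by
  obtain ⟨g, hgH, -, h1, h2⟩ := map_conj_map_twistedInversion_sectionOfUnitχ p u
  have hDτ : ε.tau.Dpt ⊓ C.Huu = ε.tau.Dpt :=
    inf_eq_left.mpr (by rw [hτ, hCH]; exact map_sectionOfUnitχ_le_Huuχ p l u)
  have hDτ' : ε.tauInv.Dpt ⊓ C.Huu = ε.tauInv.Dpt :=
    inf_eq_left.mpr (by rw [hτ', hCH]; exact map_sectionOfUnitχ_le_Huuχ p l u⁻¹)
  refine ThetaOrbitData.exists_mem_Huu_dtau_stable_of_swap ε hC hS Γ (twistedInversion (chi p)) hΓ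
    (by rw [hCH]; exact hgH l) ?_ ?_
  · rw [hDτ, hDτ', hτ, hτ']; exact h1
  · rw [hDτ, hDτ', hτ, hτ']; exact h2

/-- **R374 at `modelχ`** (the uncusped χ-model; same statement). [cite: MochizukiEtTh2009, Cor 2.8 (i) p.42] -/
theorem exists_mem_Huu_dtau_stable_modelχ {E : (ThetaSetting.modelχ p).EtaleThetaData} {l : ℕ+}
    {C : E.DoubleUnderline (l : ℕ)} (hCH : C.Huu = Huuχ p l) {T : TemperedCoverData.{0} l} (ε : C.OrbitEmbedding T)
    (hC : (ThetaSetting.modelχ p).Compat) (hS : (ThetaSetting.modelχ p).Sec2Hyps) (u : (↥(ThetaSetting.modelχ p).Kdd)ˣ)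
    (hτ : ε.tau.Dpt = (ThetaSetting.modelχ p).GKdd.map (sectionOfUnitχ p u))
    (hτ' : ε.tauInv.Dpt = (ThetaSetting.modelχ p).GKdd.map (sectionOfUnitχ p u⁻¹))
    (Γ : T.Gtp ≃ₜ* T.Gtp) (hΓ : ∀ x, Γ (ε.ι x) = ε.ι (twistedInversion (chi p) x)) :
    ∃ v ∈ C.Huu, ∀ Dt ∈ (ThetaOrbitData.ofEmbedding ε hC hS).Dtau,
      Dt.map (Γ.trans (ThetaOrbitData.innerAutTop (ε.ι v))).toMulEquiv.toMonoidHom ∈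
        (ThetaOrbitData.ofEmbedding ε hC hS).Dtau := by
  obtain ⟨g, hgH, -, h1, h2⟩ := map_conj_map_twistedInversion_sectionOfUnitχ p u
  have hDτ : ε.tau.Dpt ⊓ C.Huu = ε.tau.Dpt :=
    inf_eq_left.mpr (by rw [hτ, hCH]; exact map_sectionOfUnitχ_le_Huuχ p l u)
  have hDτ' : ε.tauInv.Dpt ⊓ C.Huu = ε.tauInv.Dpt :=
    inf_eq_left.mpr (by rw [hτ', hCH]; exact map_sectionOfUnitχ_le_Huuχ p l u⁻¹)
  refine ThetaOrbitData.exists_mem_Huu_dtau_stable_of_swap ε hC hS Γ (twistedInversion (chi p)) hΓ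
    (by rw [hCH]; exact hgH l) ?_ ?_
  · rw [hDτ, hDτ', hτ, hτ']; exact h1
  · rw [hDτ, hDτ', hτ, hτ']; exact h2

/-! ### §3. Non-vacuity at the Kummer-carrying cusped inversion model `χ′` -/

/-- The §2 hypotheses record at the cusped χ-model (`K = K̈ = ℚ_p`; `Ker(Π^tp_Y ↠ (Π^tp_Y)^ell) ⊆ Π^tp_{Y_N}`) — the carriers
are those of `modelχ` (abc-iut-L2-d1's `modelχ_sec2Hyps`, re-typed). [cite: MochizukiEtTh2009, Def 2.5 (i) p.39] -/
theorem _root_.Literature.AnabelianGeometry.EtaleTheta.ThetaSetting.modelχ'_sec2Hyps :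
    (ThetaSetting.modelχ' p).Sec2Hyps where
  Kdd_eq := (ThetaSetting.modelχ_sec2Hyps p).Kdd_eq
  ker_toEll_le_GtpYN := (ThetaSetting.modelχ_sec2Hyps p).ker_toEll_le_GtpYN

/-- **NON-VACUITY of the inner-adjusted `Dtau`-clause for `Γ := γ_{ε_±}` at `inversionModelχ′`.** For every odd `l`, every
étale-theta datum `E` over `modelχ′` and choice `X̲̲` with `Π^tp_{X̲̲} = Huuχ p l`, and every pair of non-cuspidal points of
Def. 1.9 shape (`D_τ = s_u(G_K̈)`, `D_{τ′} = s_{u⁻¹}(G_K̈)`): there are a `TemperedCoverData` `T` ON `Π^tp_C(inversionModelχ′)`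
(abc-iut-L2-d3's `temperedCoverDataOfHuuOfSection` through abc-iut-L2-t10's instance chain), an orbit embedding `ε` with
THESE points and `ε.ι = inclX`, and `Γ := γ_{ε_±} ≠ id` restricting to the twisted inversion, for which
`∃ v ∈ Π^tp_{X̲̲}, ∀ Dt ∈ Dtau, (Γ ≫ γ_{ι v})(Dt) ∈ Dtau`. [cite: MochizukiEtTh2009, Rmk 1.9.1 p.29] -/
theorem exists_orbitEmbedding_dtau_stable_inversionModelχ' {E : (ThetaSetting.modelχ' p).EtaleThetaData} {l : ℕ+}
    (hodd : Odd (l : ℕ)) (C : E.DoubleUnderline (l : ℕ)) (hCH : C.Huu = Huuχ p l)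
    (hC : (ThetaSetting.modelχ' p).Compat) (hS : (ThetaSetting.modelχ' p).Sec2Hyps)
    (u : (↥(ThetaSetting.modelχ p).Kdd)ˣ) (τ τ' : ThetaSetting.NonCuspidalPoint E.toKummerData)
    (hτ : τ.Dpt = (ThetaSetting.modelχ p).GKdd.map (sectionOfUnitχ p u))
    (hτ' : τ'.Dpt = (ThetaSetting.modelχ p).GKdd.map (sectionOfUnitχ p u⁻¹)) :
    ∃ (T : TemperedCoverData.{0} l) (ε : C.OrbitEmbedding T) (Γ : T.Gtp ≃ₜ* T.Gtp),
      T.Gtp = (MuTwoSetting.inversionModelχ' p).GtpC ∧ ε.tau = τ ∧ ε.tauInv = τ' ∧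
      (∀ x, Γ (ε.ι x) = ε.ι (twistedInversion (chi p) x)) ∧ Γ ≠ ContinuousMulEquiv.refl _ ∧
      ∃ v ∈ C.Huu, ∀ Dt ∈ (ThetaOrbitData.ofEmbedding ε hC hS).Dtau,
        Dt.map (Γ.trans (ThetaOrbitData.innerAutTop (ε.ι v))).toMulEquiv.toMonoidHom ∈
          (ThetaOrbitData.ofEmbedding ε hC hS).Dtau := by
  obtain ⟨eX⟩ := nonempty_oncePuncturedData_modelχ' p
  have hsH : ∀ σ, sectionχ' p σ ∈ C.Huu := fun σ => by rw [hCH]; exact inr_mem_Huuχ p l σ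
  have hK : (MuTwoSetting.inversionModelχ' p).barKerTp l ≤ C.Huu := hCH ▸ barKerTp_le_Huuχ_inversionModelχ' p l hodd
  let ε := (cLevelDataInvχ' p).orbitEmbeddingOfHuuOfSection (cLevelDataInvχ' p).toPiCHat
      (cLevelDataInvχ' p).isProfiniteCompletion_toPiCHat (cLevelDataInvχ' p).toPiCHat_injective eX hodd (sectionχ' p)
      (aug_sectionχ' p) (toZ_sectionχ' p) (inv_ell_piCData_inversionModelχ' p l eX)
      ((cLevelDataInvχ' p).map_inclX_GtpXu_normal l (kerToZIsCompactlyGenerated_modelχ' p))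
      ((cLevelDataInvχ' p).map_inclX_GtpY_normal (kerToZIsCompactlyGenerated_modelχ' p)) C hK hsH
      (epsPMInvχ_not_mem_range p) (iotaStable_conjX_epsPMInvχ' p C hCH) τ τ'
  have hΓ : ∀ x, ThetaOrbitData.innerAutTop ((MuTwoSetting.inversionModelχ' p).epsPM) (ε.ι x) =
      ε.ι (twistedInversion (chi p) x) := fun x =>
    MuTwoSetting.inversionModelχ'_epsPM_conj p x
  refine ⟨_, ε, ThetaOrbitData.innerAutTop ((MuTwoSetting.inversionModelχ' p).epsPM), rfl, rfl, rfl, hΓ, ?_,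
    exists_mem_Huu_dtau_stable_modelχ' p hCH ε hC hS u hτ hτ' _ hΓ⟩
  intro h
  apply twistedInversion_ne_refl (chi p)
  refine MulEquiv.ext fun x => (MuTwoSetting.inversionModelχ' p).injective_inclX ?_
  have hx := hΓ x
  rw [h] at hx
  exact hx.symm

end SettingModel

end Literature.AnabelianGeometry.EtaleTheta

end
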